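import Literature.AnabelianGeometry.SemiGraphs.TemperedCompactInVerticialOfFixedSystems
import HarnessLib

/-!
# [SemiAnbd] Thm 3.7 (iii): the fixed-systems input (FIX∞) holds wherever the condition (∗) holds

Mochizuki, *Semi-graphs of anabelioids*, Publ. RIMS **42** (2006), §3, Theorem 3.7 (iii), manuscript
pp. 40–41 [cite: MochizukiSemiAnbd2006, Thm 3.7(iii) pp.40-41], proof p. 41 with the author's *Comments*
(2020), item (6)(b): the condition "(∗_j) there exists an `i ∈ J` such that `i ≥ j` and `#E_{j,i} = 1`".

PROOF-ONLY delta (cell abc-iut, layer L3, GAP row G-t6g3-2 «Thm 3.7 (iii) / Cor 3.9 BEYOND FINITE 𝒢»,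
L3-lead ruling α28 (1); seat abc-iut-w4-d080; no definition, no new named fact).  The landed bricks
`TemperedCompactInVerticialOfFixedSystems.lean` (B1, abc-iut-L3-t10:
`VerticialLevelData.compactInVerticial_of_fixedSystems (hfix) (hadj)`) and
`TemperedCompactInVerticialAtOfFixedSystems.lean` (B2/B3, abc-iut-w4-d083: `compactInVerticialAt_of_fixedSystems`,
`cor39UpToTwistAt_of_fixedSystems`) reduce Thm 3.7 (iii) / Cor 3.9 at a countable `𝒢` to the two HYPOTHESIS
binders (FIX∞) = `hfix` (every compact `C ≠ 1` fixes a compatible system of tree vertices) + `hadj` (two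
compatible `C`-fixed systems that differ at a level are joined there by a `C`-fixed edge) over tree-level
data `D : VerticialLevelData 𝒢 c`.  This file is the CONSISTENCY / NON-VACUITY certificate of that route:

* `VerticialLevelData.hfix_of_hstar` — level data whose compact nontrivial subgroups satisfy (∗) (the tree's
  route for FINITE `𝔾`: `FiniteLevelData.hstar`, `FiniteLevelDataCpt.hstar`, from total estrangement and
  "the `𝔾_j` are all finite", p. 41) satisfy `hfix`: `C` lies in a verticial subgroup (abc-iut-L3-t10's
  `conj1_of_hstar`), which fixes a compatible system by the identification (I1);
* `VerticialLevelData.hadj_of_hstar` — and satisfy `hadj`: abc-iut-L3-t11's tree-system step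
  `SemiGraph.adjacent_of_hstar` at the level where the two systems differ;
* hence B1 fed with these two lemmas, `D.compactInVerticial_of_fixedSystems hVD h𝒢 hex (D.hfix_of_hstar hex
  hstar) (D.hadj_of_hstar hstar)`, re-proves the statement of the (∗)-route `compactInVerticial_of_hstar`
  (not restated here — gate dedup): the (FIX∞)-route loses nothing where the cell already stands, and its
  binders are satisfied at every finite `𝔾`.

Binder texts are B1's, verbatim.  Nothing here asserts (∗) or (FIX∞) for an infinite `𝔾` (there (∗) is
FALSE at abc-iut-w4-d075's `𝒢⋆` while (FIX∞) is the open residual G-t6g3-2b); nothing bears on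
[IUTchIII] Cor. 3.12.
-/

namespace Literature.AnabelianGeometry.SemiGraphs

namespace ProfiniteSemiGraph

namespace VerticialLevelData

open CategoryTheory Topology

universe v u

variable {𝒢 : ProfiniteSemiGraph.{u}} {c : TemperedPiChart 𝒢} (D : VerticialLevelData.{v} 𝒢 c)

/-- **(∗) ⇒ `hfix`.**  If the compact nontrivial subgroups of `c.G` satisfy Comments (6)(b)'s condition
(∗) on the level data `D`, then every compact `C ≠ 1` fixes a compatible system of tree vertices: `C` lies
in a verticial subgroup (`conj1_of_hstar`), and a verticial subgroup fixes a compatible system by the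
identification (I1) `D.fix` ("the unique elements of the `V_j` … form a compatible system of vertices fixed
by `H`", Comments (6)(a)). [cite: MochizukiSemiAnbd2006, Thm 3.7(iii) p.41] -/
theorem hfix_of_hstar (hex : ∀ v : 𝒢.graph.Vertex, (verticialSubgroups c v).Nonempty)
    (hstar : ∀ C : Subgroup c.G, IsCompact (C : Set c.G) → C ≠ ⊥ →
      ∀ j : D.J, ∃ (i : D.J) (h : j ≤ i), ∀ e e' : (D.tree i).Edge,
        (∀ γ : C, (D.act i γ).hom.edgeMap e = e) → (∀ γ : C, (D.act i γ).hom.edgeMap e' = e') →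
        (D.trans h).edgeMap e = (D.trans h).edgeMap e') :
    ∀ C : Subgroup c.G, IsCompact (C : Set c.G) → C ≠ ⊥ →
      ∃ x : ∀ j, (D.tree j).Vertex, (∀ ⦃i j : D.J⦄ (h : i ≤ j), (D.trans h).vertexMap (x j) = x i) ∧
        ∀ g ∈ C, ∀ j, (D.act j g).hom.vertexMap (x j) = x j := by
  intro C hC hC1
  obtain ⟨v, H, hH, hCH⟩ := D.conj1_of_hstar C hC hex (hstar C hC hC1)
  obtain ⟨x, hxc, hxf⟩ := D.fix v H hH
  exact ⟨x, hxc, fun g hg j => hxf g (hCH hg) j⟩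

/-- **(∗) ⇒ `hadj`.**  If the compact nontrivial subgroups of `c.G` satisfy (∗) on `D`, then two compatible
`C`-fixed vertex systems (`C ≠ 1` compact) that differ at a level `j` are joined there by a `C`-fixed edge —
abc-iut-L3-t11's `SemiGraph.adjacent_of_hstar` (Comments (6)(b): "these two vertices are joined to one
another by a single [closed] edge") applied at the level `j` itself. [cite: MochizukiSemiAnbd2006, Thm 3.7(iii) p.41] -/
theorem hadj_of_hstar
    (hstar : ∀ C : Subgroup c.G, IsCompact (C : Set c.G) → C ≠ ⊥ →
      ∀ j : D.J, ∃ (i : D.J) (h : j ≤ i), ∀ e e' : (D.tree i).Edge,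
        (∀ γ : C, (D.act i γ).hom.edgeMap e = e) → (∀ γ : C, (D.act i γ).hom.edgeMap e' = e') →
        (D.trans h).edgeMap e = (D.trans h).edgeMap e') :
    ∀ C : Subgroup c.G, IsCompact (C : Set c.G) → C ≠ ⊥ → ∀ x x' : ∀ j, (D.tree j).Vertex,
      (∀ ⦃i j : D.J⦄ (h : i ≤ j), (D.trans h).vertexMap (x j) = x i) →
      (∀ ⦃i j : D.J⦄ (h : i ≤ j), (D.trans h).vertexMap (x' j) = x' i) →
      (∀ g ∈ C, ∀ j, (D.act j g).hom.vertexMap (x j) = x j) →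
      (∀ g ∈ C, ∀ j, (D.act j g).hom.vertexMap (x' j) = x' j) →
      ∀ j, x j ≠ x' j → ∃ (e : (D.tree j).Edge) (b b' : (D.tree j).Branch), b ≠ b' ∧
        (D.tree j).edgeOf b = e ∧ (D.tree j).edgeOf b' = e ∧ (D.tree j).abuts b = some (x j) ∧
        (D.tree j).abuts b' = some (x' j) ∧ ∀ g ∈ C, (D.act j g).hom.edgeMap e = e := by
  intro C hC hC1 x x' hxc hx'c hxf hx'f j hj
  let ρC : ∀ j, C →* Aut (D.tree j) := fun j => (D.act j).comp C.subtype
  have hstarC : ∀ j : D.J, ∃ (i : D.J) (h : j ≤ i), ∀ e e' : (D.tree i).Edge,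
      (∀ γ : C, (ρC i γ).hom.edgeMap e = e) → (∀ γ : C, (ρC i γ).hom.edgeMap e' = e') →
      (D.trans h).edgeMap e = (D.trans h).edgeMap e' := hstar C hC hC1
  obtain ⟨e, b, b', -, hbb, hbe, hb'e, hb, hb', hfix⟩ :=
    SemiGraph.adjacent_of_hstar D.tree ρC D.trans D.isTree hstarC hxc hx'c
      (fun j γ => hxf γ γ.2 j) (fun j γ => hx'f γ γ.2 j) hj le_rfl
  exact ⟨e, b, b', hbb, hbe, hb'e, hb, hb', fun g hg => (hfix ⟨g, hg⟩).1⟩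

end VerticialLevelData

end ProfiniteSemiGraph

end Literature.AnabelianGeometry.SemiGraphs
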